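import Literature.NumberTheory.EllipticCurves.IwasawaAlgebra
import Mathlib.RingTheory.PowerSeries.Substitution
import Mathlib.RingTheory.PowerSeries.Inverse
import HarnessLib

/-!
# The Iwasawa involution `ι : Λ ≃ Λ`, `T ↦ (1 + T)⁻¹ − 1`

Topic `NumberTheory/EllipticCurves` (next to `IwasawaAlgebra*.lean`); namespace
`Literature.NumberTheory.EllipticCurves.IwasawaAlgebra`. DEFINITIONS WITH BODIES + unfolding lemmas; no named
fact, no instance, no `sorry`; Mathlib + the tree's `IwasawaAlgebra p = ℤ_p⟦T⟧` only.

On the completed group ring `ℤ_p⟦Γ⟧`, `Γ ≅ ℤ_p`, inversion `γ ↦ γ⁻¹` induces a ring involution `ι`. Under the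
identification `ℤ_p⟦Γ⟧ = ℤ_p⟦T⟧`, `γ ↦ 1 + T` (Washington §7.1 / §13.2), `ι` is the continuous `ℤ_p`-algebra
endomorphism of `ℤ_p⟦T⟧` substituting `T ↦ (1 + T)⁻¹ − 1 = −T + T² − T³ + ⋯`. It is the involution through which the
functional equation of `p`-adic `L`-functions is stated (Mazur–Tate–Teitelbaum, Ch. I §17: `L_p(ι(·))` versus
`L_p(·)`), and through which the two natural `Λ`-module structures on a Pontryagin dual `Hom(S, ℚ_p/ℤ_p)` —
`(γ·x)(s) = x(γ⁻¹ s)` (contragredient) versus `(γ·x)(s) = x(γ s)` (pre-composition) — differ (Greenberg, LNM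
1716, §1 p. 60; Kato 2004 §17.13 for the Poitou–Tate sequence as `Λ`-modules).

## What is defined / proved (`Λ = IwasawaAlgebra p`, `T = PowerSeries.X`)
* `invSubOne p : Λ` — the series `(1 + T)⁻¹ − 1` (Mathlib `PowerSeries.invOfUnit (1 + X) 1 - 1`);
  `one_add_X_mul_one_add_invSubOne` — `(1 + T)(1 + invSubOne) = 1`; `constantCoeff_invSubOne = 0`;
  `hasSubst_invSubOne` (it may be substituted).
* `invol p : Λ →ₐ[ℤ_p] Λ` — the substitution `f(T) ↦ f((1 + T)⁻¹ − 1)` (Mathlib `PowerSeries.substAlgHom`);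
  `invol_apply`, `invol_X`, `invol_C`, `invol_one_add_X` (`ι(1 + T) = (1 + T)⁻¹`), `invol_invSubOne`
  (`ι((1 + T)⁻¹ − 1) = T`, by uniqueness of inverses), **`invol_invol`** (`ι ∘ ι = id`, via Mathlib's
  `PowerSeries.subst_comp_subst_apply` and `PowerSeries.X_subst`), `invol_injective`, `invol_bijective`.
* `involEquiv p : Λ ≃ₐ[ℤ_p] Λ` — `ι` as an algebra automorphism (`AlgEquiv.ofAlgHom`), `involEquiv_apply`,
  `involEquiv_symm_apply`.
Not here (TODO, consumers: the K3 lead's repaired package R2′ of crux `SignedKatoDivisibilityUpToAtTwo` and the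
`bsd-2adic` ♭ package): transport of `Module.charIdeal` / `lengthAt` along `ι`-semilinear equivalences
(`Char(M^ι) = ι(Char M)`), and the functional-equation statements `ι(L) = u · L`.

## References
* [Washington1997] L. Washington, *Introduction to Cyclotomic Fields*, 2nd ed., §7.1 and §13.2 (`Λ ≅ ℤ_p⟦T⟧`, `γ ↦ 1 + T`).
* [MazurTateTeitelbaum1986Invent] B. Mazur, J. Tate, J. Teitelbaum, Invent. Math. 84 (1986), Ch. I §17 (the involution and the functional equation).
* [GreenbergLNM1716] R. Greenberg, LNM 1716 (1999), §1 p. 60 (the `Λ`-action on Pontryagin duals).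
-/

noncomputable section

namespace Literature.NumberTheory.EllipticCurves.IwasawaAlgebra

open PowerSeries

variable (p : ℕ) [Fact p.Prime]

/-- The power series `(1 + T)⁻¹ − 1 = −T + T² − T³ + ⋯ ∈ Λ = ℤ_p⟦T⟧`, the image of `T` under the Iwasawa
involution (`γ ↦ γ⁻¹` read through `γ ↦ 1 + T`). [cite: Washington1997, §7.1 and §13.2] -/
def invSubOne : IwasawaAlgebra p :=
  PowerSeries.invOfUnit (1 + PowerSeries.X : IwasawaAlgebra p) 1 - 1

/-- `(1 + T) · (1 + ((1 + T)⁻¹ − 1)) = 1`. [cite: Washington1997, §7.1] -/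
theorem one_add_X_mul_one_add_invSubOne :
    (1 + PowerSeries.X : IwasawaAlgebra p) * (1 + invSubOne p) = 1 := by
  rw [invSubOne, add_sub_cancel]
  exact PowerSeries.mul_invOfUnit _ 1 (by simp)

/-- `(1 + ((1 + T)⁻¹ − 1)) · (1 + T) = 1`. [cite: Washington1997, §7.1] -/
theorem one_add_invSubOne_mul_one_add_X :
    (1 + invSubOne p) * (1 + PowerSeries.X : IwasawaAlgebra p) = 1 := by
  rw [mul_comm]
  exact one_add_X_mul_one_add_invSubOne p

/-- The constant coefficient of `(1 + T)⁻¹ − 1` is `0`. [cite: Washington1997, §7.1] -/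
theorem constantCoeff_invSubOne : PowerSeries.constantCoeff (invSubOne p) = 0 := by
  simp [invSubOne]

/-- `(1 + T)⁻¹ − 1` may be substituted for `T` (its constant coefficient is nilpotent, indeed `0`). [cite: Washington1997, §7.1] -/
theorem hasSubst_invSubOne : PowerSeries.HasSubst (invSubOne p) :=
  PowerSeries.HasSubst.of_constantCoeff_zero' (constantCoeff_invSubOne p)

/-- **The Iwasawa involution** `ι : Λ → Λ`, `f(T) ↦ f((1 + T)⁻¹ − 1)`, as a `ℤ_p`-algebra endomorphism
(Mathlib's substitution of power series); it is the automorphism of `ℤ_p⟦Γ⟧` induced by `γ ↦ γ⁻¹`.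
[cite: MazurTateTeitelbaum1986Invent, Ch. I §17] [cite: Washington1997, §13.2] -/
def invol : IwasawaAlgebra p →ₐ[ℤ_[p]] IwasawaAlgebra p :=
  PowerSeries.substAlgHom (hasSubst_invSubOne p)

/-- `ι f = f.subst ((1 + T)⁻¹ − 1)` (unfolding). [cite: MazurTateTeitelbaum1986Invent, Ch. I §17] -/
theorem invol_apply (f : IwasawaAlgebra p) : invol p f = PowerSeries.subst (invSubOne p) f := by
  rw [invol, PowerSeries.coe_substAlgHom]

/-- `ι T = (1 + T)⁻¹ − 1`. [cite: MazurTateTeitelbaum1986Invent, Ch. I §17] -/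
theorem invol_X : invol p PowerSeries.X = invSubOne p := by
  rw [invol_apply, PowerSeries.subst_X (hasSubst_invSubOne p)]

/-- `ι` fixes the constants: `ι (C a) = C a`. [cite: MazurTateTeitelbaum1986Invent, Ch. I §17] -/
theorem invol_C (a : ℤ_[p]) : invol p (PowerSeries.C a) = PowerSeries.C a := by
  rw [invol_apply, PowerSeries.subst_C]
  rfl

/-- `ι (1 + T) = 1 + ((1 + T)⁻¹ − 1) = (1 + T)⁻¹`. [cite: MazurTateTeitelbaum1986Invent, Ch. I §17] -/
theorem invol_one_add_X : invol p (1 + PowerSeries.X) = 1 + invSubOne p := by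
  rw [map_add, map_one, invol_X]

/-- `ι (1 + T)` is the inverse of `1 + T`: `(1 + T) · ι(1 + T) = 1`. [cite: MazurTateTeitelbaum1986Invent, Ch. I §17] -/
theorem one_add_X_mul_invol_one_add_X : (1 + PowerSeries.X) * invol p (1 + PowerSeries.X) = 1 := by
  rw [invol_one_add_X]
  exact one_add_X_mul_one_add_invSubOne p

/-- `ι ((1 + T)⁻¹ − 1) = T`: both `ι (1 + ((1 + T)⁻¹ − 1))` and `1 + T` are inverses of `1 + ((1 + T)⁻¹ − 1)`
(apply the ring map `ι` to `(1 + T)(1 + ((1 + T)⁻¹ − 1)) = 1`). [cite: MazurTateTeitelbaum1986Invent, Ch. I §17] -/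
theorem invol_invSubOne : invol p (invSubOne p) = PowerSeries.X := by
  -- `ι(1 + a) · (1 + a) = 1` where `a = invSubOne`, from `ι((1 + T)(1 + a)) = ι 1 = 1`
  have h1 : (1 + invSubOne p) * invol p (1 + invSubOne p) = 1 := by
    have h := congrArg (invol p) (one_add_X_mul_one_add_invSubOne p)
    rwa [map_mul, map_one, invol_one_add_X] at h
  -- uniqueness of the inverse of `1 + a`
  have h2 : invol p (1 + invSubOne p) = 1 + PowerSeries.X := by
    calc invol p (1 + invSubOne p)
        = ((1 + PowerSeries.X) * (1 + invSubOne p)) * invol p (1 + invSubOne p) := by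
          rw [one_add_X_mul_one_add_invSubOne, one_mul]
      _ = (1 + PowerSeries.X) * ((1 + invSubOne p) * invol p (1 + invSubOne p)) := by ring
      _ = 1 + PowerSeries.X := by rw [h1, mul_one]
  have h3 : invol p (invSubOne p) = invol p (1 + invSubOne p) - 1 := by
    rw [map_add, map_one, add_sub_cancel_left]
  rw [h3, h2, add_sub_cancel_left]

/-- **`ι` is an involution**: `ι (ι f) = f` — substitution is functorial (`subst b (subst a f) = subst (subst b a) f`),
`ι ((1 + T)⁻¹ − 1) = T`, and substituting `T` is the identity. [cite: MazurTateTeitelbaum1986Invent, Ch. I §17] -/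
theorem invol_invol (f : IwasawaAlgebra p) : invol p (invol p f) = f := by
  have hX : PowerSeries.subst (invSubOne p) (invSubOne p) = (PowerSeries.X : IwasawaAlgebra p) := by
    rw [← invol_apply]
    exact invol_invSubOne p
  rw [invol_apply, invol_apply, PowerSeries.subst_comp_subst_apply (hasSubst_invSubOne p) (hasSubst_invSubOne p),
    hX, PowerSeries.X_subst]

/-- `ι` is injective. [cite: MazurTateTeitelbaum1986Invent, Ch. I §17] -/
theorem invol_injective : Function.Injective (invol p) :=
  Function.LeftInverse.injective (invol_invol p)

/-- `ι` is bijective. [cite: MazurTateTeitelbaum1986Invent, Ch. I §17] -/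
theorem invol_bijective : Function.Bijective (invol p) :=
  ⟨invol_injective p, Function.RightInverse.surjective (invol_invol p)⟩

/-- **The Iwasawa involution as a `ℤ_p`-algebra automorphism of `Λ`** (its own inverse).
[cite: MazurTateTeitelbaum1986Invent, Ch. I §17] [cite: Washington1997, §13.2] -/
def involEquiv : IwasawaAlgebra p ≃ₐ[ℤ_[p]] IwasawaAlgebra p :=
  AlgEquiv.ofAlgHom (invol p) (invol p) (AlgHom.ext (invol_invol p)) (AlgHom.ext (invol_invol p))

/-- `involEquiv` is `invol` (unfolding). [cite: MazurTateTeitelbaum1986Invent, Ch. I §17] -/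
theorem involEquiv_apply (f : IwasawaAlgebra p) : involEquiv p f = invol p f := rfl

/-- The inverse of `involEquiv` is `invol` again (unfolding). [cite: MazurTateTeitelbaum1986Invent, Ch. I §17] -/
theorem involEquiv_symm_apply (f : IwasawaAlgebra p) : (involEquiv p).symm f = invol p f := rfl

/-- `ι (T) · (1 + T) = −T`: the image of `T` is `−T · (1 + T)⁻¹`, i.e. `T` times a unit of `Λ` up to sign
(so `ι` preserves the augmentation ideal `(T)`). [cite: MazurTateTeitelbaum1986Invent, Ch. I §17] -/
theorem invol_X_mul_one_add_X : invol p PowerSeries.X * (1 + PowerSeries.X) = -PowerSeries.X := by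
  have h := one_add_invSubOne_mul_one_add_X p
  rw [invol_X]
  -- `(1 + a)(1 + T) = 1` ⇒ `a (1 + T) = 1 − (1 + T) = −T`
  have : invSubOne p * (1 + PowerSeries.X) = (1 + invSubOne p) * (1 + PowerSeries.X) - (1 + PowerSeries.X) := by
    ring
  rw [this, h]
  ring

end Literature.NumberTheory.EllipticCurves.IwasawaAlgebra

end
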